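import Summits.CriticalPhenomena.SAWScalingLimit.Theses.SAWQuarterTwist
import Summits.CriticalPhenomena.SAWScalingLimit.Theorems.SAWDefectDecoherenceObservableToSLERResidueAssembly3

/-!
# Line `conditional-abundance` — crux `ObservableToSLER` (stmt-CriticalPhenomena-14005), strategist s5 ALTERNATIVE LINE
# (registered additively; it does NOT replace the lead's live skeleton `Lines/bridge_gate_renewal.lean`, r15)

The live line closes the crux modulo {S1 abundance (item stmt-17698), T1⁻ macro source locality (item stmt-17955),
simplicity (item stmt-7148)} and the solid squeeze (provable).  This line (r2) is the SAME composition through the landed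
three-item residue glue `Residue.observableToSLER_of_residue3` (p165010; squeeze discharged by the landed
`Squeeze.carvedReduction_squeezeSolid`, twin p163920) with ONE change at the hardest stub:

* `stub_nestedRenewalConditional` — abundance CONDITIONAL on the crux's own hypothesis `HexTight` and on the
  simplicity residue (item 7148):  `HexTight → HexSimpleSubseqLimits → ⟨S1 body verbatim⟩`.

Why this is a genuine weakening of the research target and not a costume (card `Lines/conditional-abundance.md` §2):
the "never returns to `S n`" clause of a good gate is decided by the WHOLE future of the walk, so an unconditional
proof of S1 must control MACROSCOPIC BACKTRACKING to the root (after reaching distance `R′` the walk re-enters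
`B(a, r)`) — a boundary two-arm species for which no lattice tool exists — whereas under `HexTight` + simplicity of
subsequential limits that control is SOFT: the backtracking events are closed in `CurveClass ℂ`, decrease in `r` to
"the limit curve revisits its source", which a simple curve class cannot do; Prokhorov + portmanteau give
`NoMacroBacktracking` below.  What remains of abundance is then local to the scales `[ρ, 2R]` (octave renewal +
cages), see STRATEGY-CENSUS.md (s5) §Transfer T5.2 / §Decomposition D5.2.  Both extra hypotheses are free in the
composition (`hT` is a hypothesis of the crux, simplicity is stub 3), so `ObservableToSLER_of` is unchanged in cost.

Stubs (3, r2): `stub_nestedRenewalConditional` (NEW, hardest), `stub_macroSourceLocality` (= item 17955 = registered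
stub of r13–r16, verbatim), `stub_hexSimpleSubseqLimits` (= item 7148, by name).  (r1 had a fourth stub, the solid
squeeze; it is now the landed theorem `Squeeze.carvedReduction_squeezeSolid`, p163920, consumed inside p165010.)
Composition: `ObservableToSLER_of` (explicit hypotheses) / `ObservableToSLER_proof`; route copies `Iff.rfl`
(`ObservableToSLER_proof_quarterTwist`).  Sorries ONLY in the three `stub_*`.
-/

noncomputable section

open scoped BigOperators Topology NNReal ENNReal Classical BoundedContinuousFunction
open Filter Set MeasureTheory Metric
open Literature.Probability.LatticeModels (HexVertex hexGraph hexCenter triZeta Site polyline)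
open Literature.Probability.RandomPlanarGeometry
open Literature.Probability.RandomPlanarGeometry.SAW
open UpperHalfPlane (upperHalfPlaneSet)
open Summit.CriticalPhenomena.SAWScalingLimit.Theorems.ObservableToSLER.BridgeGate
open Summit.CriticalPhenomena.SAWScalingLimit.Theorems.ObservableToSLER.NestedGate

namespace Summit.CriticalPhenomena.SAWScalingLimit.Cruxes.ObservableToSLER.ConditionalAbundance

open Summit.CriticalPhenomena.SAWScalingLimit.Theses.SAWDefectDecoherence (HexObservableLimitR HexTight ObservableToSLER)
open Summit.CriticalPhenomena.SAWScalingLimit.Theses.SAWLatticeVirasoro (HexSimpleSubseqLimits)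

/-! ## The three stubs (r2) -/

/-- **Stub 1 (NEW, the hardest): CONDITIONAL ABUNDANCE** — S1 (`stub_nestedRenewalFatCoSolidR`, item stmt-17698,
body verbatim) under the crux hypothesis `HexTight` and the simplicity residue `HexSimpleSubseqLimits` (item 7148).
Intended use of the hypotheses: `NoMacroBacktracking` (below) is soft from them, so the "never returns" clause of
the first good gate costs only LOCAL returns at scales `≤ 2R`; the remaining content is octave renewal abundance of
clean single crossings near an arbitrary root (research; census T5.2, D5.2). -/
theorem stub_nestedRenewalConditional :
    HexTight → HexSimpleSubseqLimits →
          ∀ (D : DobrushinDomain) (a b : ℝ → HexVertex), IsEmbEndpointApprox hexGraph hexCenter D a b →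
            ∀ ε > (0 : ℝ), ∃ R₂ > (0 : ℝ), ∀ R ∈ Set.Ioc (0 : ℝ) R₂, ∃ ρ > (0 : ℝ), ∃ N : ℕ, ∀ᶠ δ : ℝ in 𝓝[>] 0,
              ∃ S T : ℕ → Set HexVertex,
                TameNestedFamily δ R N (a δ) S ∧ TameNestedFamily δ R N (b δ) T ∧
                ((∀ n, ExteriorAnchored D.carrier δ (S n) (a δ)) ∧
                  (∀ n, ExteriorAnchored D.carrier δ (T n) (b δ)) ∧
                  ∃ j : Fin 6,
                    ((∀ (n : ℕ) (p q : HexVertex), HasCleanWindow D.carrier δ ρ (S n) p q →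
                        rowOf j q = rowOf j p + 1 ∧
                          ∀ x : HexVertex, (δ : ℂ) * hexCenter x ∈ ball ((δ : ℂ) * hexCenter q) ρ →
                            (x ∈ S n ↔ rowOf j x ≤ rowOf j p)) ∧
                      (∀ (n : ℕ) (p q : HexVertex), HasCleanWindow D.carrier δ ρ (T n) p q →
                        rowOf j q = rowOf j p + 1 ∧
                          ∀ x : HexVertex, (δ : ℂ) * hexCenter x ∈ ball ((δ : ℂ) * hexCenter q) ρ →
                            (x ∈ T n ↔ rowOf j x ≤ rowOf j p))) ∧
                    (∀ (n : ℕ) (p q : HexVertex), HasCleanWindow D.carrier δ ρ (S n) p q →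
                      ∃ K : Set ℂ, IsCompact K ∧ IsConnected K ∧
                        (δ : ℂ) * hexCenter q - ((ρ / 2 : ℝ) : ℂ) * Complex.I * triZeta ^ (j : ℕ) ∈ K ∧
                        (δ : ℂ) * hexCenter (a δ) ∈ K ∧
                        ∀ v : HexVertex, Metric.infDist ((δ : ℂ) * hexCenter v) K ≤ ρ / 4 → v ∈ S n) ∧
                    (∀ (n : ℕ) (p q : HexVertex), HasCleanWindow D.carrier δ ρ (T n) p q →
                      ∃ K : Set ℂ, IsCompact K ∧ IsConnected K ∧
                        (δ : ℂ) * hexCenter q - ((ρ / 2 : ℝ) : ℂ) * Complex.I * triZeta ^ (j : ℕ) ∈ K ∧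
                        (δ : ℂ) * hexCenter (b δ) ∈ K ∧
                        ∀ v : HexVertex, Metric.infDist ((δ : ℂ) * hexCenter v) K ≤ ρ / 4 → v ∈ T n) ∧
                    (∀ n : ℕ, ∃ K : Set ℂ, IsCompact K ∧ IsConnected K ∧ (δ : ℂ) * hexCenter (a δ) ∈ K ∧
                      (∀ v : HexVertex, Metric.infDist ((δ : ℂ) * hexCenter v) K ≤ ρ / 8 → v ∈ S n) ∧
                      (∀ v ∈ S n, ∃ (t w : HexVertex) (r : ℕ), v ∈ hexBall t r ∧ w ∈ hexBall t r ∧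
                        hexBall t r ⊆ S n ∧ Metric.infDist ((δ : ℂ) * hexCenter w) K ≤ ρ / 16)) ∧
                    (∀ n : ℕ, ∃ K : Set ℂ, IsCompact K ∧ IsConnected K ∧ (δ : ℂ) * hexCenter (b δ) ∈ K ∧
                      (∀ v : HexVertex, Metric.infDist ((δ : ℂ) * hexCenter v) K ≤ ρ / 8 → v ∈ T n) ∧
                      (∀ v ∈ T n, ∃ (t w : HexVertex) (r : ℕ), v ∈ hexBall t r ∧ w ∈ hexBall t r ∧
                        hexBall t r ⊆ T n ∧ Metric.infDist ((δ : ℂ) * hexCenter w) K ≤ ρ / 16))) ∧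
                hexSAWLaw D.carrier δ (a δ) (b δ)
                    {γ | ¬ ∃ (n m : ℕ) (p q : HexVertex) (n' m' : ℕ) (p' q' : HexVertex),
                        IsFirstGoodGateN D.carrier δ ρ R S (a δ) γ.walk.support n m p q ∧
                        IsFirstGoodGateN D.carrier δ ρ R T (b δ) γ.walk.support.reverse n' m' p' q' ∧
                        WideLink D.carrier δ ρ (S n ∪ T n') q q'} ≤
                  ENNReal.ofReal ε := by
  sorry

/-- **Stub 2: MACROSCOPIC SOURCE LOCALITY** (= item stmt-CriticalPhenomena-17955 = registered `stub_macroSourceLocality`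
of r13–r15, verbatim the second hypothesis of the landed glue). -/
theorem stub_macroSourceLocality :
          ∀ (E : DobrushinDomain) (ρ : ℝ) (Λ : ℝ → Finset HexVertex) (m₀ : ℝ → ℤ)
            (a : ℝ → Sym2 HexVertex),
            0 < ρ → E.carrier ∩ ball (E.pt 0) ρ = {z : ℂ | (E.pt 0).im < z.im} ∩ ball (E.pt 0) ρ →
            (∀ᶠ δ : ℝ in 𝓝[>] 0, hexDomainSimplyConnected (Λ δ) ∧
              (hexGraph.induce (↑(Λ δ) : Set HexVertex)).Preconnected ∧ a δ ∈ hexDomainBoundary (Λ δ) ∧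
              (∀ v ∈ Λ δ, (δ : ℂ) * hexCenter v ∈ E.carrier) ∧
              (∀ v : HexVertex, (δ : ℂ) * hexCenter v ∈ ball (E.pt 0) ρ → (v ∈ Λ δ ↔ m₀ δ ≤ v.1 1))) →
            (∀ K : Set ℂ, IsCompact K → K ⊆ E.carrier →
              ∀ᶠ δ : ℝ in 𝓝[>] 0, ∀ v : HexVertex, (δ : ℂ) * hexCenter v ∈ K → v ∈ Λ δ) →
            Tendsto (fun δ : ℝ => (δ : ℂ) * hexMidpoint (a δ)) (𝓝[>] 0) (𝓝 (E.pt 0)) →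
            ∀ ε : ℝ, 0 < ε → ∀ r : ℝ, 0 < r → ∃ t₀ : ℝ, 0 < t₀ ∧
              ∀ (s : ℝ → Sym2 HexVertex) (t : ℝ), t ≠ 0 → |t| < t₀ →
                (∀ᶠ δ : ℝ in 𝓝[>] 0, s δ ∈ hexDomainBoundary (Λ δ) ∧
                  (hexMidpoint (s δ)).im = (hexMidpoint (a δ)).im) →
                Tendsto (fun δ : ℝ => (δ : ℂ) * hexMidpoint (s δ)) (𝓝[>] 0) (𝓝 (E.pt 0 + t)) →
                ∀ᶠ δ : ℝ in 𝓝[>] 0,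
                  (∑ γ : HexMidEdgeSAW (Λ δ) (a δ) (s δ),
                      if ∃ v ∈ γ.verts, r ≤ dist ((δ : ℂ) * hexCenter v) ((δ : ℂ) * hexMidpoint (a δ))
                      then hexCriticalFugacity ^ γ.length else 0) ≤
                    ε * ∑ γ : HexMidEdgeSAW (Λ δ) (a δ) (s δ), hexCriticalFugacity ^ γ.length := by
  sorry

/-- **Stub 3: SIMPLICITY of subsequential limits** (= item stmt-CriticalPhenomena-7148, by name). -/
theorem stub_hexSimpleSubseqLimits : HexSimpleSubseqLimits := by
  sorry

/-! ## The soft consequence that motivates stub 1's hypotheses (typed; NOT a stub, not used in the composition) -/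

/-- **No macroscopic backtracking to the root** (typed target of the first lemma of this line): for every `R′ > 0`
and `ε > 0` there is `r > 0` such that eventually in `δ` the critical walk from `a δ` to `b δ` re-enters the closed
`r`-ball about `pt 0` AFTER having reached distance `≥ R′` from it — or, time-reversed at the target, leaves the
`r`-ball about `pt 1` to distance `≥ R′` after having entered it — with probability `≤ ε` each.  Claimed provable from
`HexTight` + `HexSimpleSubseqLimits`: the events are closed in `CurveClass ℂ` and decrease, as `r → 0`, to "the
curve revisits its source after leaving `B(pt 0, R′)`" (resp. visits its target before the end), null for every simple
class from `pt 0` to `pt 1`; Prokhorov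
(`IsTightAlongMesh`) + portmanteau along any violating sequence `δ_k → 0⁺`. -/
def NoMacroBacktracking : Prop :=
  ∀ (D : DobrushinDomain) (a b : ℝ → HexVertex), IsEmbEndpointApprox hexGraph hexCenter D a b →
    ∀ R' > (0 : ℝ), ∀ ε > (0 : ℝ), ∃ r > (0 : ℝ), ∀ᶠ δ : ℝ in 𝓝[>] 0,
      hexSAWLaw D.carrier δ (a δ) (b δ)
          {γ | ∃ (l₁ l₂ : List HexVertex) (u v : HexVertex), γ.walk.support = l₁ ++ u :: l₂ ∧ v ∈ l₂ ∧
            R' ≤ dist ((δ : ℂ) * hexCenter u) (D.pt 0) ∧ dist ((δ : ℂ) * hexCenter v) (D.pt 0) ≤ r} ≤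
        ENNReal.ofReal ε ∧
      hexSAWLaw D.carrier δ (a δ) (b δ)
          {γ | ∃ (l₁ l₂ : List HexVertex) (u v : HexVertex), γ.walk.support = l₁ ++ u :: l₂ ∧ v ∈ l₂ ∧
            dist ((δ : ℂ) * hexCenter u) (D.pt 1) ≤ r ∧ R' ≤ dist ((δ : ℂ) * hexCenter v) (D.pt 1)} ≤
        ENNReal.ofReal ε

/-- The shape of the intended first lemma (documentation only; proving it is stub-1 work). -/
def FirstLemma : Prop := HexTight → HexSimpleSubseqLimits → NoMacroBacktracking

/-! ## Composition: the crux BY NAME from the three stub statements -/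

/-- **`ObservableToSLER_of`** — the crux from the three stub STATEMENTS (explicit hypotheses, real proof): the landed
three-item residue glue (p165010) with abundance fed by the conditional stub at the crux's own `HexTight` and at simplicity. -/
theorem ObservableToSLER_of
    (h1 : HexTight → HexSimpleSubseqLimits →
            ∀ (D : DobrushinDomain) (a b : ℝ → HexVertex), IsEmbEndpointApprox hexGraph hexCenter D a b →
              ∀ ε > (0 : ℝ), ∃ R₂ > (0 : ℝ), ∀ R ∈ Set.Ioc (0 : ℝ) R₂, ∃ ρ > (0 : ℝ), ∃ N : ℕ, ∀ᶠ δ : ℝ in 𝓝[>] 0,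
                ∃ S T : ℕ → Set HexVertex,
                  TameNestedFamily δ R N (a δ) S ∧ TameNestedFamily δ R N (b δ) T ∧
                  ((∀ n, ExteriorAnchored D.carrier δ (S n) (a δ)) ∧
                    (∀ n, ExteriorAnchored D.carrier δ (T n) (b δ)) ∧
                    ∃ j : Fin 6,
                      ((∀ (n : ℕ) (p q : HexVertex), HasCleanWindow D.carrier δ ρ (S n) p q →
                          rowOf j q = rowOf j p + 1 ∧
                            ∀ x : HexVertex, (δ : ℂ) * hexCenter x ∈ ball ((δ : ℂ) * hexCenter q) ρ →
                              (x ∈ S n ↔ rowOf j x ≤ rowOf j p)) ∧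
                        (∀ (n : ℕ) (p q : HexVertex), HasCleanWindow D.carrier δ ρ (T n) p q →
                          rowOf j q = rowOf j p + 1 ∧
                            ∀ x : HexVertex, (δ : ℂ) * hexCenter x ∈ ball ((δ : ℂ) * hexCenter q) ρ →
                              (x ∈ T n ↔ rowOf j x ≤ rowOf j p))) ∧
                      (∀ (n : ℕ) (p q : HexVertex), HasCleanWindow D.carrier δ ρ (S n) p q →
                        ∃ K : Set ℂ, IsCompact K ∧ IsConnected K ∧
                          (δ : ℂ) * hexCenter q - ((ρ / 2 : ℝ) : ℂ) * Complex.I * triZeta ^ (j : ℕ) ∈ K ∧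
                          (δ : ℂ) * hexCenter (a δ) ∈ K ∧
                          ∀ v : HexVertex, Metric.infDist ((δ : ℂ) * hexCenter v) K ≤ ρ / 4 → v ∈ S n) ∧
                      (∀ (n : ℕ) (p q : HexVertex), HasCleanWindow D.carrier δ ρ (T n) p q →
                        ∃ K : Set ℂ, IsCompact K ∧ IsConnected K ∧
                          (δ : ℂ) * hexCenter q - ((ρ / 2 : ℝ) : ℂ) * Complex.I * triZeta ^ (j : ℕ) ∈ K ∧
                          (δ : ℂ) * hexCenter (b δ) ∈ K ∧
                          ∀ v : HexVertex, Metric.infDist ((δ : ℂ) * hexCenter v) K ≤ ρ / 4 → v ∈ T n) ∧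
                      (∀ n : ℕ, ∃ K : Set ℂ, IsCompact K ∧ IsConnected K ∧ (δ : ℂ) * hexCenter (a δ) ∈ K ∧
                        (∀ v : HexVertex, Metric.infDist ((δ : ℂ) * hexCenter v) K ≤ ρ / 8 → v ∈ S n) ∧
                        (∀ v ∈ S n, ∃ (t w : HexVertex) (r : ℕ), v ∈ hexBall t r ∧ w ∈ hexBall t r ∧
                          hexBall t r ⊆ S n ∧ Metric.infDist ((δ : ℂ) * hexCenter w) K ≤ ρ / 16)) ∧
                      (∀ n : ℕ, ∃ K : Set ℂ, IsCompact K ∧ IsConnected K ∧ (δ : ℂ) * hexCenter (b δ) ∈ K ∧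
                        (∀ v : HexVertex, Metric.infDist ((δ : ℂ) * hexCenter v) K ≤ ρ / 8 → v ∈ T n) ∧
                        (∀ v ∈ T n, ∃ (t w : HexVertex) (r : ℕ), v ∈ hexBall t r ∧ w ∈ hexBall t r ∧
                          hexBall t r ⊆ T n ∧ Metric.infDist ((δ : ℂ) * hexCenter w) K ≤ ρ / 16))) ∧
                  hexSAWLaw D.carrier δ (a δ) (b δ)
                      {γ | ¬ ∃ (n m : ℕ) (p q : HexVertex) (n' m' : ℕ) (p' q' : HexVertex),
                          IsFirstGoodGateN D.carrier δ ρ R S (a δ) γ.walk.support n m p q ∧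
                          IsFirstGoodGateN D.carrier δ ρ R T (b δ) γ.walk.support.reverse n' m' p' q' ∧
                          WideLink D.carrier δ ρ (S n ∪ T n') q q'} ≤
                    ENNReal.ofReal ε)
    (h2 :
            ∀ (E : DobrushinDomain) (ρ : ℝ) (Λ : ℝ → Finset HexVertex) (m₀ : ℝ → ℤ)
              (a : ℝ → Sym2 HexVertex),
              0 < ρ → E.carrier ∩ ball (E.pt 0) ρ = {z : ℂ | (E.pt 0).im < z.im} ∩ ball (E.pt 0) ρ →
              (∀ᶠ δ : ℝ in 𝓝[>] 0, hexDomainSimplyConnected (Λ δ) ∧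
                (hexGraph.induce (↑(Λ δ) : Set HexVertex)).Preconnected ∧ a δ ∈ hexDomainBoundary (Λ δ) ∧
                (∀ v ∈ Λ δ, (δ : ℂ) * hexCenter v ∈ E.carrier) ∧
                (∀ v : HexVertex, (δ : ℂ) * hexCenter v ∈ ball (E.pt 0) ρ → (v ∈ Λ δ ↔ m₀ δ ≤ v.1 1))) →
              (∀ K : Set ℂ, IsCompact K → K ⊆ E.carrier →
                ∀ᶠ δ : ℝ in 𝓝[>] 0, ∀ v : HexVertex, (δ : ℂ) * hexCenter v ∈ K → v ∈ Λ δ) →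
              Tendsto (fun δ : ℝ => (δ : ℂ) * hexMidpoint (a δ)) (𝓝[>] 0) (𝓝 (E.pt 0)) →
              ∀ ε : ℝ, 0 < ε → ∀ r : ℝ, 0 < r → ∃ t₀ : ℝ, 0 < t₀ ∧
                ∀ (s : ℝ → Sym2 HexVertex) (t : ℝ), t ≠ 0 → |t| < t₀ →
                  (∀ᶠ δ : ℝ in 𝓝[>] 0, s δ ∈ hexDomainBoundary (Λ δ) ∧
                    (hexMidpoint (s δ)).im = (hexMidpoint (a δ)).im) →
                  Tendsto (fun δ : ℝ => (δ : ℂ) * hexMidpoint (s δ)) (𝓝[>] 0) (𝓝 (E.pt 0 + t)) →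
                  ∀ᶠ δ : ℝ in 𝓝[>] 0,
                    (∑ γ : HexMidEdgeSAW (Λ δ) (a δ) (s δ),
                        if ∃ v ∈ γ.verts, r ≤ dist ((δ : ℂ) * hexCenter v) ((δ : ℂ) * hexMidpoint (a δ))
                        then hexCriticalFugacity ^ γ.length else 0) ≤
                      ε * ∑ γ : HexMidEdgeSAW (Λ δ) (a δ) (s δ), hexCriticalFugacity ^ γ.length)
    (h3 : HexSimpleSubseqLimits) :
    ObservableToSLER := fun hR hT =>
  Summit.CriticalPhenomena.SAWScalingLimit.Theorems.ObservableToSLER.Residue.observableToSLER_of_residue3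
    (h1 hT h3) h2 h3 hR hT

/-- The crux, modulo exactly the three stubs. -/
theorem ObservableToSLER_proof : ObservableToSLER :=
  ObservableToSLER_of stub_nestedRenewalConditional stub_macroSourceLocality stub_hexSimpleSubseqLimits

/-- The bet route's copy (SAWQuarterTwist) is the same term. -/
theorem ObservableToSLER_proof_quarterTwist :
    Summit.CriticalPhenomena.SAWScalingLimit.Theses.SAWQuarterTwist.ObservableToSLER :=
  ObservableToSLER_proof

end Summit.CriticalPhenomena.SAWScalingLimit.Cruxes.ObservableToSLER.ConditionalAbundance

end
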